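import Mathlib
import Summits.Ventures.HodgeRepro.Tier4.Line1.HeckeFiniteness

/-!
# Tier4/Line1/HeckeFinitenessType — HECKE FINITENESS FOR A FINITE-RANK LEFT-`K`-TYPE: a test function of level `K_f`
and archimedean type `σ` meets only finitely many blocks of the spectral expansion

Blind re-derivation cell `pub-hodge-repro`, Tier 4 (README §9–§10), seat t4-L1-p1 (gen 3).  Target tree path
`lean/Summits/Ventures/HodgeRepro/Tier4/Line1/HeckeFinitenessType.lean`.  Imports this seat's `HeckeFiniteness`
(p680820: `exists_finset_doubleCoset_cover`, `inner_self_ne_zero_of_invariant`, `inner_finset_sum_left`,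
`inner_zero_left`, `invariant_finset_sum`) and through it `SpectralOfRTF` / `SpectralRegroup`.

WHAT THIS IS.  `HeckeFiniteness` proves the finiteness of the block support for a LEFT-`K`-INVARIANT `f₁` with `K` open —
on an adelic group `K ⊇ G⁰` contains the archimedean identity component, so this is the TRIVIAL archimedean type
(t4-crit-2's scope note S13587).  The honest shape of a level-`K_f`, archimedean-type-`σ` test function is a FINITE-RANK
left-`K`-decomposition: `f₁ (k⁻¹ g) = ∑ i, e i k * c i g` for `k ∈ K = K_f × K_∞` with the `e i` matrix coefficients of
`σ` on `K_∞` (times `1` on `K_f`) and the `c i` test functions (`r = (dim σ)²`; `r = 1`, `e = 1`, `c = f₁` is the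
invariant case).  THEOREM (`finite_specBlock_support_of_finiteRank`): for an open `K` and such a decomposition,
`{m | specBlock S χ χ' φ n f₁ f₂ m ≠ 0}` is finite.  Proof: `R_mul_right_eq_sum` — `R f ψ (x k) = ∑ i, e i k * R (c i) ψ x`
(the substitution `g ↦ k⁻¹ g`, left Haar invariance, `integral_finset_sum`) — so every `R (f̄₁) φ_j` has its right-`K`-coset
functions `k ↦ ψ (x k)` in the finite-dimensional `E := span (range e)` (`HasLeftType`); the evaluation
`ψ ↦ (g, k) ↦ ψ (g k)` on the representatives `s` of `Gk\G/K` is injective on `Gk`-invariant functions (every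
`x = γ g k`; no right-invariance needed), lands in the finite-dimensional `s → E`, and the orthogonality + positivity
argument of `HeckeFiniteness` makes the functions of distinct `τ m` linearly independent — at most `finrank (s → E)`
indices `m`.  Scope (honest): `K` open ⇒ `K ⊇ G⁰`, so a non-zero `f₁` exists only when the archimedean part of `G` is
compact (L1's totally definite seesaw plane); the archimedean TYPE is now free.  0 print.  NOT claimed: the seesaw
identity (S1a), the isolation (S3), or `P_T4`.  Nothing here says anything about the status of the Hodge conjecture for
CM abelian varieties, which is NOT proved (HC_CM is NOT proved by anyone in this repository).
-/

set_option autoImplicit false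

noncomputable section

namespace Summit.Ventures.HodgeRepro.Tier4.Line1

open MeasureTheory Topology
open scoped Pointwise

namespace RTF

namespace Setting

variable {G : Type} [Group G] [TopologicalSpace G] [IsTopologicalGroup G] [MeasurableSpace G] [BorelSpace G]
  (S : Setting G)

section LeftType

variable (K : Subgroup G) {r : ℕ} (e : Fin r → K → ℂ)

/-- **a function has left `K`-type `e`**: each of its right-`K`-coset functions `k ↦ ψ (x k)` lies in the span of the
`e i`. -/
def HasLeftType (ψ : G → ℂ) : Prop :=
  ∀ x : G, (fun k : K => ψ (x * k)) ∈ Submodule.span ℂ (Set.range e)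

omit [TopologicalSpace G] [IsTopologicalGroup G] [MeasurableSpace G] [BorelSpace G] in
/-- finite linear combinations of functions of left `K`-type `e` have left `K`-type `e`. -/
theorem hasLeftType_finset_sum {ι : Type} (F : Finset ι) (c : ι → ℂ) (ψ : ι → G → ℂ)
    (h : ∀ i ∈ F, HasLeftType K e (ψ i)) : HasLeftType K e fun x => ∑ i ∈ F, c i * ψ i x := by
  intro x
  have hfun : (fun k : K => ∑ i ∈ F, c i * ψ i (x * k)) = ∑ i ∈ F, c i • fun k : K => ψ i (x * k) := by
    funext k
    simp [Finset.sum_apply, Pi.smul_apply, smul_eq_mul]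
  simp only
  rw [hfun]
  exact Submodule.sum_mem _ fun i hi => Submodule.smul_mem _ _ (h i hi x)

/-- **the right translates of `R f ψ` along a finite-rank left-`K`-decomposition of `f`**:
`R f ψ (x k) = ∑ i, e i k * R (c i) ψ x` (the substitution `g ↦ k⁻¹ g` and the left invariance of the Haar measure). -/
theorem R_mul_right_eq_sum [MeasurableMul G] {f : G → ℂ} (c : Fin r → G → ℂ) (hc : ∀ i, IsTest (c i))
    (hdec : ∀ (k : K) (g : G), f ((k : G)⁻¹ * g) = ∑ i, e i k * c i g) {ψ : G → ℂ} (hψ : Continuous ψ) (x : G)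
    (k : K) : S.R f ψ (x * k) = ∑ i, e i k * S.R (c i) ψ x := by
  haveI := S.haar
  unfold R
  have h1 : (fun g => f g * ψ (x * k * g)) = fun g => (fun g' => f ((k : G)⁻¹ * g') * ψ (x * g')) ((k : G) * g) := by
    funext g
    simp only [inv_mul_cancel_left, mul_assoc]
  rw [h1, integral_mul_left_eq_self (fun g' => f ((k : G)⁻¹ * g') * ψ (x * g')) (k : G)]
  simp_rw [hdec k, Finset.sum_mul]
  rw [integral_finsetSum]
  · refine Finset.sum_congr rfl fun i _ => ?_
    simp_rw [mul_assoc]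
    exact integral_const_mul _ _
  · intro i _
    have hcont : Continuous (fun g => c i g * ψ (x * g)) :=
      (hc i).cont.mul (hψ.comp (continuous_const.mul continuous_id))
    have hcs : HasCompactSupport (fun g => c i g * ψ (x * g)) := (hc i).compact.mul_right
    have hint : Integrable (fun g => c i g * ψ (x * g)) S.μ := hcont.integrable_of_hasCompactSupport hcs
    refine (hint.const_mul (e i k)).congr (Filter.Eventually.of_forall fun g => ?_)
    simp only
    ring

/-- `R f ψ` has left `K`-type `e` whenever `f` has a finite-rank left-`K`-decomposition along `e`. -/
theorem hasLeftType_R [MeasurableMul G] {f : G → ℂ} (c : Fin r → G → ℂ) (hc : ∀ i, IsTest (c i))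
    (hdec : ∀ (k : K) (g : G), f ((k : G)⁻¹ * g) = ∑ i, e i k * c i g) {ψ : G → ℂ} (hψ : Continuous ψ) :
    HasLeftType K e (S.R f ψ) := by
  intro x
  have h : (fun k : K => S.R f ψ (x * k)) = ∑ i, S.R (c i) ψ x • e i := by
    funext k
    rw [S.R_mul_right_eq_sum K e c hc hdec hψ x k]
    simp [Finset.sum_apply, Pi.smul_apply, smul_eq_mul, mul_comm]
  rw [h]
  exact Submodule.sum_mem _ fun i _ => Submodule.smul_mem _ _ (Submodule.subset_span ⟨i, rfl⟩)

end LeftType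

section Counting

variable (K : Subgroup G)

/-- **evaluation on the cosets of the representatives**: `ψ ↦ (g, k) ↦ ψ (g k)`. -/
def evalCosets (s : Finset G) (ψ : G → ℂ) : s → K → ℂ := fun g k => ψ (g * k)

omit [IsTopologicalGroup G] [BorelSpace G] in
/-- a `Gk`-invariant function vanishing on the cosets of the representatives vanishes. -/
theorem eq_zero_of_evalCosets_eq_zero {s : Finset G}
    (hs : ∀ x : G, ∃ g ∈ s, ∃ γ : S.Gk, ∃ k ∈ K, x = (γ : G) * g * k) {ψ : G → ℂ} (hinv : S.Invariant ψ)
    (h0 : evalCosets K s ψ = 0) : ψ = 0 := by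
  funext x
  obtain ⟨g, hg, γ, k, hk, rfl⟩ := hs x
  rw [mul_assoc, hinv γ (g * k)]
  have := congrFun (congrFun h0 ⟨g, hg⟩) ⟨k, hk⟩
  exact this

omit [IsTopologicalGroup G] in
/-- **linear independence of the coset evaluations**: non-zero continuous `Gk`-invariant functions taken from
distinct invariant subspaces of an adapted family are linearly independent under `evalCosets` (no right-invariance
needed: the injectivity uses only `Gk`-invariance). -/
theorem linearIndependent_evalCosets [Countable S.Gk] [MeasurableMul G] {s : Finset G}
    (hs : ∀ x : G, ∃ g ∈ s, ∃ γ : S.Gk, ∃ k ∈ K, x = (γ : G) * g * k) {τ : ℕ → Set (G → ℂ)}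
    {φ : ℕ → G → ℂ} {n : ℕ → ℕ} (hB : S.IsAdaptedONB τ φ n) {ι : Type} (idx : ι → ℕ)
    (hidx : Function.Injective idx) (ψ : ι → G → ℂ) (hmem : ∀ i, ψ i ∈ τ (idx i)) (hne : ∀ i, ψ i ≠ 0) :
    LinearIndependent ℂ fun i : ι => evalCosets K s (ψ i) := by
  have hcont : ∀ i, Continuous (ψ i) := fun i => (hB.inv (idx i)).cont _ (hmem i)
  have hinv : ∀ i, S.Invariant (ψ i) := fun i => (hB.inv (idx i)).inv _ (hmem i)
  rw [linearIndependent_iff']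
  intro t c hsum i₀ hi₀
  set Ψ : G → ℂ := fun x => ∑ i ∈ t, c i * ψ i x with hΨ
  have hΨ0 : Ψ = 0 := by
    refine S.eq_zero_of_evalCosets_eq_zero K hs (S.invariant_finset_sum t c ψ fun i _ => hinv i) ?_
    funext g k
    have h := congrFun (congrFun hsum g) k
    simp only [Finset.sum_apply, Pi.smul_apply, smul_eq_mul, Pi.zero_apply, evalCosets] at h
    simpa [evalCosets, hΨ] using h
  have hpair : S.inner Ψ (ψ i₀) = c i₀ * S.inner (ψ i₀) (ψ i₀) := by
    rw [hΨ, S.inner_finset_sum_left (ψ i₀) (hcont i₀) t c ψ fun i _ => hcont i]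
    rw [Finset.sum_eq_single i₀]
    · intro i _ hi
      have hidx' : idx i ≠ idx i₀ := fun h => hi (hidx h)
      rw [hB.orthSub (idx i) (idx i₀) hidx' (ψ i) (hmem i) (ψ i₀) (hmem i₀), mul_zero]
    · intro h
      exact absurd hi₀ h
  rw [hΨ0, S.inner_zero_left] at hpair
  have hself := S.inner_self_ne_zero_of_invariant (hcont i₀) (hinv i₀) (hne i₀)
  exact (mul_eq_zero.mp hpair.symm).resolve_right hself

/-- **at most `finrank (s → span e)` invariant subspaces carry a non-zero function of left `K`-type `e`.** -/
theorem finite_leftType_support [Countable S.Gk] [MeasurableMul G] (hK : IsOpen (K : Set G)) {r : ℕ}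
    (e : Fin r → K → ℂ) {τ : ℕ → Set (G → ℂ)} {φ : ℕ → G → ℂ} {n : ℕ → ℕ} (hB : S.IsAdaptedONB τ φ n) :
    {m : ℕ | ∃ ψ ∈ τ m, ψ ≠ 0 ∧ HasLeftType K e ψ}.Finite := by
  obtain ⟨s, hs⟩ := S.exists_finset_doubleCoset_cover K hK
  set E : Submodule ℂ (K → ℂ) := Submodule.span ℂ (Set.range e) with hE
  haveI : FiniteDimensional ℂ E := FiniteDimensional.span_of_finite ℂ (Set.finite_range e)
  by_contra hinf
  obtain ⟨M, hMsub, hMcard⟩ :=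
    (Set.not_finite.mp hinf).exists_subset_card_eq (Module.finrank ℂ (s → E) + 1)
  have hchoice : ∀ m : M, ∃ ψ : G → ℂ, ψ ∈ τ m ∧ ψ ≠ 0 ∧ HasLeftType K e ψ := fun m => hMsub m.2
  choose ψ hψ using hchoice
  -- the evaluations land in `s → E`
  let v : M → (s → E) := fun m g => ⟨evalCosets K s (ψ m) g, (hψ m).2.2 g⟩
  have hv : LinearIndependent ℂ v := by
    refine LinearIndependent.of_comp (LinearMap.pi fun g : s => E.subtype ∘ₗ LinearMap.proj g) ?_
    have hli := S.linearIndependent_evalCosets K hs hB (fun m : M => (m : ℕ)) Subtype.val_injective ψ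
      (fun m => (hψ m).1) (fun m => (hψ m).2.1)
    have hcomp : (⇑(LinearMap.pi fun g : s => E.subtype ∘ₗ LinearMap.proj g) ∘ v) =
        fun i => evalCosets K s (ψ i) := by
      funext i g
      rfl
    rw [hcomp]
    exact hli
  have hcard := hv.fintype_card_le_finrank
  rw [Fintype.card_coe, hMcard] at hcard
  omega

end Counting

section Main

variable (χ : S.T → ℂ) (χ' : S.T' → ℂ) (φ : ℕ → G → ℂ) (n : ℕ → ℕ) (f₁ f₂ : G → ℂ) (K : Subgroup G)

/-- a non-zero `m`-block of an `f₁` with a finite-rank left-`K`-decomposition along `e` puts a non-zero function of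
left `K`-type `conj ∘ e` into `τ m` (namely `R (f̄₁) φ_j` for a term of the block). -/
theorem exists_leftType_of_specBlock_ne_zero [MeasurableMul G] {τ : ℕ → Set (G → ℂ)} (hB : S.IsAdaptedONB τ φ n)
    (h₁ : IsTest f₁) {r : ℕ} (e : Fin r → K → ℂ) (c : Fin r → G → ℂ) (hc : ∀ i, IsTest (c i))
    (hdec : ∀ (k : K) (g : G), f₁ ((k : G)⁻¹ * g) = ∑ i, e i k * c i g) {m : ℕ}
    (h : specBlock S χ χ' φ n f₁ f₂ m ≠ 0) :
    ∃ ψ ∈ τ m, ψ ≠ 0 ∧ HasLeftType K (fun i k => starRingEnd ℂ (e i k)) ψ := by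
  obtain ⟨j, hj, hne⟩ := S.exists_specTerm_ne_zero_of_specBlock_ne_zero χ χ' φ n f₁ f₂ h
  have hP : S.periodT χ (fun t => S.R (cj f₁) (φ j) t) ≠ 0 := by
    intro h0
    apply hne
    unfold specTerm
    rw [h0]
    simp
  have hR : S.R (cj f₁) (φ j) ≠ 0 := by
    intro h0
    apply hP
    unfold periodT
    simp [h0]
  refine ⟨S.R (cj f₁) (φ j), ?_, hR, ?_⟩
  · rw [← hj]
    exact (hB.inv (n j)).conv (φ j) (hB.mem j) (cj f₁) h₁.cj
  · have hdec' : ∀ (k : K) (g : G), cj f₁ ((k : G)⁻¹ * g) = ∑ i, starRingEnd ℂ (e i k) * cj (c i) g := by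
      intro k g
      unfold cj
      rw [hdec k g, map_sum]
      refine Finset.sum_congr rfl fun i _ => ?_
      rw [map_mul]
    exact S.hasLeftType_R K (fun i k => starRingEnd ℂ (e i k)) (fun i => cj (c i)) (fun i => (hc i).cj) hdec'
      ((hB.inv (n j)).cont _ (hB.mem j))

/-- **HECKE FINITENESS FOR A FINITE-RANK LEFT-`K`-TYPE** (the theorem of record of this file): for an open subgroup `K`
and a test function `f₁` with a finite-rank left-`K`-decomposition `f₁ (k⁻¹ g) = ∑ i, e i k * c i g` (`c i` test
functions), only finitely many blocks of the spectral expansion of `J(f₁ ⋆ f₂)` are non-zero. -/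
theorem finite_specBlock_support_of_finiteRank [Countable S.Gk] (hK : IsOpen (K : Set G))
    {τ : ℕ → Set (G → ℂ)} (hB : S.IsAdaptedONB τ φ n) (h₁ : IsTest f₁) {r : ℕ} (e : Fin r → K → ℂ)
    (c : Fin r → G → ℂ) (hc : ∀ i, IsTest (c i))
    (hdec : ∀ (k : K) (g : G), f₁ ((k : G)⁻¹ * g) = ∑ i, e i k * c i g) :
    {m : ℕ | specBlock S χ χ' φ n f₁ f₂ m ≠ 0}.Finite := by
  refine (S.finite_leftType_support K hK (fun i k => starRingEnd ℂ (e i k)) hB).subset fun m hm => ?_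
  exact S.exists_leftType_of_specBlock_ne_zero χ χ' φ n f₁ f₂ K hB h₁ e c hc hdec hm

/-- **the finite spectrum of a level and a type**: a `Finset` carrying every non-zero block. -/
theorem exists_finset_specBlock_support_of_finiteRank [Countable S.Gk] (hK : IsOpen (K : Set G))
    {τ : ℕ → Set (G → ℂ)} (hB : S.IsAdaptedONB τ φ n) (h₁ : IsTest f₁) {r : ℕ} (e : Fin r → K → ℂ)
    (c : Fin r → G → ℂ) (hc : ∀ i, IsTest (c i))
    (hdec : ∀ (k : K) (g : G), f₁ ((k : G)⁻¹ * g) = ∑ i, e i k * c i g) :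
    ∃ s : Finset ℕ, ∀ m ∉ s, specBlock S χ χ' φ n f₁ f₂ m = 0 := by
  have hfin := S.finite_specBlock_support_of_finiteRank χ χ' φ n f₁ f₂ K hK hB h₁ e c hc hdec
  refine ⟨hfin.toFinset, fun m hm => ?_⟩
  by_contra hne
  exact hm (hfin.mem_toFinset.mpr hne)

omit [TopologicalSpace G] [IsTopologicalGroup G] [MeasurableSpace G] [BorelSpace G] in
/-- the left-`K`-invariant case is the rank-one decomposition `e = 1`, `c = f₁`. -/
theorem finiteRank_of_left_invariant {f : G → ℂ} (hf : ∀ k ∈ K, ∀ g, f (k * g) = f g) :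
    ∀ (k : K) (g : G), f ((k : G)⁻¹ * g) = ∑ i : Fin 1, (fun _ _ => (1 : ℂ)) i k * f g := by
  intro k g
  rw [hf ((k : G)⁻¹) (K.inv_mem k.2) g]
  simp

end Main

end Setting

end RTF

end Summit.Ventures.HodgeRepro.Tier4.Line1

end
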